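import Literature.Geometry.Symplectic.PfaffianFour
import Literature.Topology.FourManifolds.SmoothOrientation
import Mathlib.Geometry.Manifold.MFDeriv.Tangent
import HarnessLib

/-!
# Unfolding of an origami 4-manifold — proofs companion (step 0: the fold as a regular zero set)

Companion of `OrigamiUnfolding.lean`, which states the NAMED FACT
`Literature.Geometry.Symplectic.exists_symplecticCutPieces_of_isOrigamiForm` (A. Cannas da Silva,
V. Guillemin, A. R. Pires, *Symplectic Origami*, IMRN 2011 = arXiv:0909.4065
[`CannasdasilvaGuilleminPires2010`], Prop. 2.8 with Def. 2.13 and the proof of Prop. 2.26: the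
symplectic cut pieces `(M₀^±, ω₀^±)` of a compact oriented origami manifold and the blow-down
maps `M^± ∪ 𝒰 → M₀^±`). Everything in this file is proved; no named facts; two definitions
(`orientationSign`, `posSide` = the side `M⁺(o, ω)` of §2.1). It imports `PfaffianFour.lean`
(hence `OrigamiForm.lean`: `pfaffian`, `fold`, `IsFoldedForm`, `IsOrigamiForm`,
`pfaffian_eq_zero_iff`, `pfaffian_compContinuousLinearMap`, `mem_fold_iff_pfaffian_eq_zero`) and
`Literature/Topology/FourManifolds/SmoothOrientation.lean` (`SmoothOrientation`, `IsOrientable`).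

## Why the fact is not discharged here (fact seat, triage `XL`)

The printed proof of Prop. 2.8 (pp. 5–7 of the arXiv text) runs: (S0) for oriented `M` the
complement of the fold `Z` splits as `M⁺ ⊔ M⁻` by the sign of `ωⁿ` (§2.1); (S1) a Moser model
`φ : Z × (-ε, ε) → 𝒰`, `φ*ω = p*i*ω + d(t² p*α)` with `α` an `S¹`-connection form
(Cannas da Silva–Guillemin–Woodward 2000, Thm. 1: tubular neighbourhood, connection form of the
free circle action, relative Moser isotopy); (S2) the cut piece near the centre is the reduced
space `μ⁻¹(0)/S¹` of `Z × (-ε², ε²) × ℂ`, i.e. the associated disc bundle `Z ×_{S¹} D²` over the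
base `B = Z/S¹`, with its reduced symplectic form, `B` embedded symplectically and `𝒰⁺` embedded
as an open dense subset by `j⁺ (ψ (x, s)) = [x, s, √(2s)]`; (S3) `M₀⁺ = M⁺ ∪_{𝒰⁺} (Z ×_{S¹} D²)`
by open gluing, compact and Hausdorff, with the glued form; (S4) the blow-down map
`β (φ (x, t)) = [x, t², t√2]` (Def. 2.13 (1), (3), (4), proof of Prop. 2.26). The tree has the
tubular neighbourhood theorem for compact hypersurfaces
(`Literature/Geometry/Riemannian/NormalExpTubular.lean`), global and time-dependent flows
(`Literature/Geometry/Manifold/CompleteFlow.lean`, `TimeDependentFlowIcc.lean`) and the open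
gluing of manifolds (`Literature/Topology/FourManifolds/GluingConstruction.lean`), but neither
Mathlib nor Literature has a manifold structure on the orbit space of a free smooth action of a
compact Lie group (the quotient manifold / slice theorem — `Geometry/Manifold/QuotientManifold.lean`
treats covering-space actions only; the same gap is recorded in
`Literature/Barriers/SmoothPoincare4/CircleActionsStandardProofs.lean`), nor symplectic reduction,
nor a Cartan / Lie-derivative calculus for the chart-wise forms `MForm` needed for the Moser
step, nor differential forms on a glued manifold. Steps (S1)–(S4) are therefore each a theory of
their own; under the fact discipline (D-0026) none of them is minted here as a further unproved
fact. What this file proves is step (S0): the fold is, chart by chart, the zero set of the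
chart Pfaffian of `IsFoldedForm.transverse`, a closed nowhere dense set, and for an orientation
`o` its complement is the disjoint union of the two non-empty open sides `M⁺ = posSide o s`,
`M⁻ = posSide (-o) s` — the first conjunct of `exists_symplecticCutPieces_of_isOrigamiForm`
(`IsOrigamiForm.exists_sides`).

## Contents (all proved)

* `pfaffian_ne_zero_iff` (non-degeneracy is `Pf ≠ 0`), `alt_two_compContinuousLinearMap`,
  `pfaffian_compContinuousLinearMap_eq_zero_iff` (degeneracy is invariant under linear
  automorphisms; companion of `pfaffian_compContinuousLinearMap` of `PfaffianFour.lean`).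
* `symm_mem_fold_iff_pfaffian_inChart`, `mem_fold_iff_pfaffian_inChart`,
  `mem_fold_iff_pfaffian_inChart_self`: **in the chart at `x₀` the fold is the zero set of the
  chart Pfaffian** `y ↦ Pf (s.inChart x₀ y)` (the derivative of the inverse extended chart is
  invertible, Mathlib's `isInvertible_mfderivWithin_extChartAt_symm`). This substantiates the
  reading of Def. 2.1 in `OrigamiForm.lean` ("the degeneracy locus; on `ℝ⁴`, `det = Pf²`, so this
  is the zero set of the Pfaffian") for the chart Pfaffian that `IsFoldedForm.transverse` uses.
* `contDiff_alt_two_eval`, `contDiff_pfaffian`; `isClosed_fold_of_isSmoothForm` (**the fold of a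
  smooth `2`-form is closed**), `isOpen_compl_fold_of_isSmoothForm`;
  `IsFoldedForm.interior_fold_eq_empty`, `IsFoldedForm.dense_compl_fold` (**the fold of a folded
  form is nowhere dense**: at an interior point the chart Pfaffian would vanish near the centre,
  so its derivative there would be zero, contradicting `ω ∧ ω ⋔ 0`); the `IsOrigamiForm`
  corollaries.
* **The sides** (§2.1 "`M ∖ Z` decomposes into open subsets `M⁺` where `ωⁿ > 0` and `M⁻` where
  `ωⁿ < 0`"): `orientationSign o x = ±1` (the orientation `o x` against the standard one of
  `ℝ⁴`), `posSide o s = {x | 0 < orientationSign o x * Pf (s x)}` (`M⁺`; `M⁻ = posSide (-o) s`,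
  `mem_posSide_neg_iff`); `disjoint_posSide_posSide_neg`, `posSide_union_posSide_neg`
  (`M⁺ ⊔ M⁻ = M ∖ Z`); `eventually_orientationSign_mul_pfaffian_inChart` (**chart comparison**:
  near `x₀` the signed chart Pfaffian `ε(o,x₀) Pf (s.inChart x₀ (φ y))` is a positive multiple
  of `ε(o,y) Pf (s y)` — functoriality `Pf (f*α) = det f · Pf α` of `PfaffianFour.lean`,
  `det dφ · det dφ⁻¹ = 1`, and the local constancy clause of `SmoothOrientation`);
  `isOpen_posSide`; `IsFoldedForm.mem_closure_posSide` (at a fold point the chart Pfaffian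
  vanishes with non-zero derivative, so it takes both signs on a line through the centre,
  arbitrarily close to it: `Z ⊆ closure M⁺`), `IsFoldedForm.posSide_nonempty`,
  `IsFoldedForm.closure_posSide` (`closure M⁺ = M⁺ ∪ Z`), **`IsFoldedForm.frontier_posSide`**
  (`∂M⁺ = Z`: the fold is the common frontier of the two sides);
  **`IsOrigamiForm.exists_sides`** — conjunct one of the named fact: disjoint non-empty open
  `V 0, V 1` with `(V 0 ∪ V 1)ᶜ = fold s`, for an orientable `M` and a non-empty fold.

Not here: connectedness of `M^±` for connected `M` and `Z` (needs a collar of `Z`), and steps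
(S1)–(S4).

## References

* [CannasdasilvaGuilleminPires2010] A. Cannas da Silva, V. Guillemin, A. R. Pires, *Symplectic
  Origami*, IMRN 2011, 4252–4293 = arXiv:0909.4065, §2.1 (Def. 2.1, `M ∖ Z = M⁺ ⊔ M⁻`), §2.2
  Prop. 2.8, Def. 2.13, Prop. 2.26.
* A. Cannas da Silva, V. Guillemin, C. Woodward, *On the unfolding of folded symplectic
  structures*, Math. Res. Lett. 7 (2000) 35–53, Thm. 1 (Moser model), Thm. 7 (unfolding).
-/

noncomputable section

open scoped Manifold ContDiff Topology
open Set Function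
open Literature.Geometry.Kaehler

namespace Literature.Geometry.Symplectic

/-! ### Degeneracy and linear automorphisms -/

section Pfaffian

variable (α : (EuclideanSpace ℝ (Fin 4)) [⋀^Fin 2]→L[ℝ] ℝ)

/-- Non-degeneracy of a `2`-form on `ℝ⁴` is `Pf ≠ 0`. [folklore] -/
theorem pfaffian_ne_zero_iff :
    pfaffian α ≠ 0 ↔ ∀ v : EuclideanSpace ℝ (Fin 4), v ≠ 0 → ∃ w, α ![v, w] ≠ 0 := by
  rw [Ne, pfaffian_eq_zero_iff]
  push Not
  rfl

/-- The pull-back `f*β` evaluated on a pair: `(f*β) ![v, w] = β ![f v, f w]`. [folklore] -/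
theorem alt_two_compContinuousLinearMap {V W : Type*} [NormedAddCommGroup V] [NormedSpace ℝ V]
    [NormedAddCommGroup W] [NormedSpace ℝ W] (β : W [⋀^Fin 2]→L[ℝ] ℝ) (f : V →L[ℝ] W) (v w : V) :
    β.compContinuousLinearMap f ![v, w] = β ![f v, f w] := by
  rw [ContinuousAlternatingMap.compContinuousLinearMap_apply]
  congr 1
  funext i
  fin_cases i <;> rfl

/-- The vanishing of the Pfaffian (degeneracy) is invariant under pull-back by a linear
automorphism of `ℝ⁴` (the quantitative rule is `pfaffian_compContinuousLinearMap`: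
`Pf (f*α) = det f · Pf α`). [folklore] -/
theorem pfaffian_compContinuousLinearMap_eq_zero_iff
    {f : (EuclideanSpace ℝ (Fin 4)) →L[ℝ] EuclideanSpace ℝ (Fin 4)} (hf : Function.Bijective f) :
    pfaffian (α.compContinuousLinearMap f) = 0 ↔ pfaffian α = 0 := by
  rw [pfaffian_eq_zero_iff, pfaffian_eq_zero_iff]
  constructor
  · rintro ⟨v, hv0, hv⟩
    refine ⟨f v, fun h => hv0 (hf.1 (by rw [h, map_zero])), fun w => ?_⟩
    obtain ⟨u, rfl⟩ := hf.2 w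
    rw [← alt_two_compContinuousLinearMap]
    exact hv u
  · rintro ⟨v, hv0, hv⟩
    obtain ⟨u, rfl⟩ := hf.2 v
    refine ⟨u, fun h => hv0 (by rw [h, map_zero]), fun w => ?_⟩
    rw [alt_two_compContinuousLinearMap]
    exact hv (f w)

end Pfaffian

/-! ### The fold is the zero set of the chart Pfaffian -/

section Fold

variable {M : Type*} [TopologicalSpace M] [ChartedSpace (EuclideanSpace ℝ (Fin 4)) M]
  [IsManifold (𝓡 4) 1 M]

/-- In the chart at `x₀`: a point of the chart domain lies on the fold iff the chart Pfaffian
`y ↦ Pf (s.inChart x₀ y)` of `IsFoldedForm.transverse` vanishes there: the chart representative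
is the pull-back of `s` by the derivative of the inverse extended chart, which is invertible on
the chart target (Mathlib's `isInvertible_mfderivWithin_extChartAt_symm`).
[cite: CannasdasilvaGuilleminPires2010, Def. 2.1] -/
theorem symm_mem_fold_iff_pfaffian_inChart (s : MForm (𝓡 4) M ℝ 2) (x₀ : M)
    {y : EuclideanSpace ℝ (Fin 4)} (hy : y ∈ (extChartAt (𝓡 4) x₀).target) :
    (extChartAt (𝓡 4) x₀).symm y ∈ fold s ↔ pfaffian (s.inChart x₀ y) = 0 := by
  rw [mem_fold_iff_pfaffian_eq_zero]
  have hinv := isInvertible_mfderivWithin_extChartAt_symm (I := 𝓡 4) hy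
  exact (pfaffian_compContinuousLinearMap_eq_zero_iff _ hinv.bijective).symm

/-- The fold inside a chart domain is the preimage of the zero set of the chart Pfaffian.
[cite: CannasdasilvaGuilleminPires2010, Def. 2.1] -/
theorem mem_fold_iff_pfaffian_inChart (s : MForm (𝓡 4) M ℝ 2) (x₀ : M) {x : M}
    (hx : x ∈ (extChartAt (𝓡 4) x₀).source) :
    x ∈ fold s ↔ pfaffian (s.inChart x₀ (extChartAt (𝓡 4) x₀ x)) = 0 := by
  rw [← symm_mem_fold_iff_pfaffian_inChart s x₀ ((extChartAt (𝓡 4) x₀).map_source hx),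
    (extChartAt (𝓡 4) x₀).left_inv hx]

/-- A point lies on the fold iff the chart Pfaffian of its own chart vanishes at the centre.
[cite: CannasdasilvaGuilleminPires2010, Def. 2.1] -/
theorem mem_fold_iff_pfaffian_inChart_self (s : MForm (𝓡 4) M ℝ 2) (x₀ : M) :
    x₀ ∈ fold s ↔ pfaffian (s.inChart x₀ (extChartAt (𝓡 4) x₀ x₀)) = 0 :=
  mem_fold_iff_pfaffian_inChart s x₀ (mem_extChartAt_source x₀)

end Fold

/-! ### Regularity of the Pfaffian and topological consequences -/

section Regularity

/-- Evaluation at fixed vectors is a `C^∞` (bounded linear) function of the form. [folklore] -/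
theorem contDiff_alt_two_eval (v : Fin 2 → EuclideanSpace ℝ (Fin 4)) :
    ContDiff ℝ ∞ fun α : (EuclideanSpace ℝ (Fin 4)) [⋀^Fin 2]→L[ℝ] ℝ => α v := by
  have h : IsBoundedLinearMap ℝ fun α : (EuclideanSpace ℝ (Fin 4)) [⋀^Fin 2]→L[ℝ] ℝ => α v := by
    refine ⟨⟨fun a b => rfl, fun c a => rfl⟩, (∏ i, ‖v i‖) + 1, by positivity, fun α => ?_⟩
    calc ‖α v‖ ≤ ‖α‖ * ∏ i, ‖v i‖ := α.le_opNorm v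
      _ ≤ ((∏ i, ‖v i‖) + 1) * ‖α‖ := by
        nlinarith [norm_nonneg α,
          Finset.prod_nonneg fun i (_ : i ∈ Finset.univ) => norm_nonneg (v i)]
  exact h.contDiff

/-- The Pfaffian is a `C^∞` (polynomial) function of the form. [folklore] -/
theorem contDiff_pfaffian :
    ContDiff ℝ ∞ fun α : (EuclideanSpace ℝ (Fin 4)) [⋀^Fin 2]→L[ℝ] ℝ => pfaffian α := by
  simp only [pfaffian]
  exact (((contDiff_alt_two_eval _).mul (contDiff_alt_two_eval _)).sub
    ((contDiff_alt_two_eval _).mul (contDiff_alt_two_eval _))).add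
    ((contDiff_alt_two_eval _).mul (contDiff_alt_two_eval _))

variable {M : Type*} [TopologicalSpace M] [ChartedSpace (EuclideanSpace ℝ (Fin 4)) M]

/-- For a smooth form the chart Pfaffian at `x₀` is continuous at the centre of the chart
(chart-wise smoothness `IsSmoothForm` is smoothness of `s.inChart x₀` at the centre). [folklore] -/
theorem continuousAt_pfaffian_inChart_of_isSmoothForm {s : MForm (𝓡 4) M ℝ 2}
    (hs : IsSmoothForm s) (x₀ : M) :
    ContinuousAt (fun y => pfaffian (s.inChart x₀ y)) (extChartAt (𝓡 4) x₀ x₀) := by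
  have h1 : ContDiffWithinAt ℝ ∞ (s.inChart x₀) univ (extChartAt (𝓡 4) x₀ x₀) := by
    have := hs x₀
    rwa [ModelWithCorners.Boundaryless.range_eq_univ] at this
  have h2 : ContinuousAt (s.inChart x₀) (extChartAt (𝓡 4) x₀ x₀) :=
    (h1.contDiffAt Filter.univ_mem).continuousAt
  exact continuous_pfaffian.continuousAt.comp h2

variable [IsManifold (𝓡 4) 1 M]

/-- **The fold of a smooth `2`-form on a 4-manifold is closed.** In the chart at a point `x₀` of
its closure the fold is the zero set of the chart Pfaffian (`mem_fold_iff_pfaffian_inChart`),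
which is continuous at the centre, and the fold accumulates at `x₀`; hence the chart Pfaffian
vanishes at the centre. (For an origami form this also follows from compactness of the fold,
`IsOrigamiForm.isCompact_fold`, in a Hausdorff `M`.) [folklore] -/
theorem isClosed_fold_of_isSmoothForm {s : MForm (𝓡 4) M ℝ 2} (hs : IsSmoothForm s) :
    IsClosed (fold s) := by
  refine isClosed_of_closure_subset fun x₀ hx₀ => ?_
  have hG : Filter.Tendsto (fun x => pfaffian (s.inChart x₀ (extChartAt (𝓡 4) x₀ x))) (𝓝 x₀)
      (𝓝 (pfaffian (s.inChart x₀ (extChartAt (𝓡 4) x₀ x₀)))) :=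
    (continuousAt_pfaffian_inChart_of_isSmoothForm hs x₀).comp (continuousAt_extChartAt x₀)
  have hfreq : ∃ᶠ x in 𝓝 x₀,
      pfaffian (s.inChart x₀ (extChartAt (𝓡 4) x₀ x)) ∈ ({0} : Set ℝ) := by
    have h1 := (mem_closure_iff_frequently.1 hx₀).and_eventually
      (extChartAt_source_mem_nhds (I := 𝓡 4) x₀)
    exact h1.mono fun x hx => (mem_fold_iff_pfaffian_inChart s x₀ hx.2).1 hx.1
  have h0 := mem_closure_of_frequently_of_tendsto hfreq hG
  rw [closure_singleton, mem_singleton_iff] at h0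
  exact (mem_fold_iff_pfaffian_inChart_self s x₀).2 h0

/-- The complement `M ∖ Z` of the fold of a smooth `2`-form is open (§2.1: "the complement
`M ∖ Z` decomposes into open subsets `M⁺` … and `M⁻`"). [cite: CannasdasilvaGuilleminPires2010, §2.1] -/
theorem isOpen_compl_fold_of_isSmoothForm {s : MForm (𝓡 4) M ℝ 2} (hs : IsSmoothForm s) :
    IsOpen (fold s)ᶜ :=
  (isClosed_fold_of_isSmoothForm hs).isOpen_compl

variable {N : Type} [TopologicalSpace N] [ChartedSpace (EuclideanSpace ℝ (Fin 3)) N] {j : N → M}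

/-- **The fold of a folded form has empty interior**: at an interior point the chart Pfaffian
would vanish identically near the centre of the chart, so its derivative there would be zero,
contradicting the transversality clause `ω ∧ ω ⋔ 0` of Def. 2.1 ("`ωⁿ` vanishes transversally
on a submanifold `Z` … necessarily of codimension one"). [cite: CannasdasilvaGuilleminPires2010, Def. 2.1] -/
theorem IsFoldedForm.interior_fold_eq_empty {s : MForm (𝓡 4) M ℝ 2} (h : IsFoldedForm s N j) :
    interior (fold s) = ∅ := by
  refine Set.eq_empty_iff_forall_notMem.2 fun x₀ hx₀ => ?_
  have hxf : x₀ ∈ fold s := interior_subset hx₀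
  have hnhds : fold s ∈ 𝓝 x₀ := mem_interior_iff_mem_nhds.1 hx₀
  have hpre : (extChartAt (𝓡 4) x₀).symm ⁻¹' fold s ∈ 𝓝 (extChartAt (𝓡 4) x₀ x₀) :=
    extChartAt_preimage_mem_nhds hnhds
  have htgt : (extChartAt (𝓡 4) x₀).target ∈ 𝓝 (extChartAt (𝓡 4) x₀ x₀) :=
    extChartAt_target_mem_nhds x₀
  have hg : (fun y => pfaffian (s.inChart x₀ y)) =ᶠ[𝓝 (extChartAt (𝓡 4) x₀ x₀)]
      fun _ => (0 : ℝ) := by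
    filter_upwards [hpre, htgt] with y hy hyt
    exact (symm_mem_fold_iff_pfaffian_inChart s x₀ hyt).1 hy
  apply h.transverse x₀ hxf
  rw [hg.fderiv_eq]
  exact fderiv_const_apply 0

/-- The complement of the fold of a folded form is dense (the fold is a hypersurface, Def. 2.1).
[cite: CannasdasilvaGuilleminPires2010, Def. 2.1] -/
theorem IsFoldedForm.dense_compl_fold {s : MForm (𝓡 4) M ℝ 2} (h : IsFoldedForm s N j) :
    Dense (fold s)ᶜ :=
  interior_eq_empty_iff_dense_compl.1 h.interior_fold_eq_empty

/-- The fold of a folded form is closed. [cite: CannasdasilvaGuilleminPires2010, Def. 2.1] -/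
theorem IsFoldedForm.isClosed_fold {s : MForm (𝓡 4) M ℝ 2} (h : IsFoldedForm s N j) :
    IsClosed (fold s) :=
  isClosed_fold_of_isSmoothForm h.smooth

/-- The complement of the fold of a folded form is open and dense.
[cite: CannasdasilvaGuilleminPires2010, Def. 2.1] -/
theorem IsFoldedForm.isOpen_dense_compl_fold {s : MForm (𝓡 4) M ℝ 2} (h : IsFoldedForm s N j) :
    IsOpen (fold s)ᶜ ∧ Dense (fold s)ᶜ :=
  ⟨h.isClosed_fold.isOpen_compl, h.dense_compl_fold⟩

/-- The fold of an origami form has empty interior. [cite: CannasdasilvaGuilleminPires2010, Def. 2.2] -/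
theorem IsOrigamiForm.interior_fold_eq_empty {s : MForm (𝓡 4) M ℝ 2} (h : IsOrigamiForm s) :
    interior (fold s) = ∅ := by
  obtain ⟨N, _, _, _, _, j, hf⟩ := h.exists_isFoldedForm
  exact hf.interior_fold_eq_empty

/-- The complement of the fold of an origami form is dense.
[cite: CannasdasilvaGuilleminPires2010, Def. 2.2] -/
theorem IsOrigamiForm.dense_compl_fold {s : MForm (𝓡 4) M ℝ 2} (h : IsOrigamiForm s) :
    Dense (fold s)ᶜ :=
  interior_eq_empty_iff_dense_compl.1 h.interior_fold_eq_empty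

/-- The fold of an origami form is closed — smooth-form version, no Hausdorff hypothesis (compare
`IsOrigamiForm.isCompact_fold`). [cite: CannasdasilvaGuilleminPires2010, Def. 2.2] -/
theorem IsOrigamiForm.isClosed_fold' {s : MForm (𝓡 4) M ℝ 2} (h : IsOrigamiForm s) :
    IsClosed (fold s) :=
  isClosed_fold_of_isSmoothForm h.isSmoothForm

/-- The complement of the fold of an origami form is open.
[cite: CannasdasilvaGuilleminPires2010, §2.1] -/
theorem IsOrigamiForm.isOpen_compl_fold {s : MForm (𝓡 4) M ℝ 2} (h : IsOrigamiForm s) :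
    IsOpen (fold s)ᶜ :=
  h.isClosed_fold'.isOpen_compl

end Regularity

/-! ### The two sides `M⁺`, `M⁻` of the fold of an oriented 4-manifold -/

section Sides

open Literature.Topology.FourManifolds

variable {M : Type*} [TopologicalSpace M] [ChartedSpace (EuclideanSpace ℝ (Fin 4)) M]
  [IsManifold (𝓡 4) ∞ M]

/-- The sign `ε(o, x) = ±1` of the orientation `o x` of `T_x M = ℝ⁴` (read in the preferred chart
at `x`) against the standard orientation `euclideanOrientation 4` of `ℝ⁴`; used to read the sign of
`ωⁿ` ("`M⁺` where `ωⁿ > 0`", §2.1) chart-independently. [cite: CannasdasilvaGuilleminPires2010, §2.1] -/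
def orientationSign (o : SmoothOrientation (𝓡 4) M) (x : M) : ℝ := by
  classical exact if o x = euclideanOrientation 4 then 1 else -1

/-- `ε(o, x) = 1` when `o x` is the standard orientation. [folklore] -/
theorem orientationSign_of_eq {o : SmoothOrientation (𝓡 4) M} {x : M}
    (h : o x = euclideanOrientation 4) : orientationSign o x = 1 := by
  classical
  simp [orientationSign, h]

/-- `ε(o, x) = -1` when `o x` is not the standard orientation. [folklore] -/
theorem orientationSign_of_ne {o : SmoothOrientation (𝓡 4) M} {x : M}
    (h : o x ≠ euclideanOrientation 4) : orientationSign o x = -1 := by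
  classical
  simp [orientationSign, h]

/-- Two orientations of `ℝ⁴` are equal or opposite (Mathlib's `Orientation.eq_or_eq_neg`). [folklore] -/
theorem orientation_four_eq_or_eq_neg
    (x₁ x₂ : Orientation ℝ (EuclideanSpace ℝ (Fin 4))
      (Fin (Module.finrank ℝ (EuclideanSpace ℝ (Fin 4))))) : x₁ = x₂ ∨ x₁ = -x₂ :=
  Orientation.eq_or_eq_neg x₁ x₂ (Fintype.card_fin _)

/-- `ε(o, x) = ±1`. [folklore] -/
theorem orientationSign_eq_one_or (o : SmoothOrientation (𝓡 4) M) (x : M) :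
    orientationSign o x = 1 ∨ orientationSign o x = -1 := by
  by_cases h : o x = euclideanOrientation 4
  · exact Or.inl (orientationSign_of_eq h)
  · exact Or.inr (orientationSign_of_ne h)

/-- `ε(o, x) ≠ 0`. [folklore] -/
theorem orientationSign_ne_zero (o : SmoothOrientation (𝓡 4) M) (x : M) :
    orientationSign o x ≠ 0 := by
  rcases orientationSign_eq_one_or o x with h | h <;> rw [h] <;> norm_num

/-- `ε(o, x)² = 1`. [folklore] -/
theorem orientationSign_mul_self (o : SmoothOrientation (𝓡 4) M) (x : M) :
    orientationSign o x * orientationSign o x = 1 := by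
  rcases orientationSign_eq_one_or o x with h | h <;> rw [h] <;> norm_num

/-- Points with the same orientation have the same sign. [folklore] -/
theorem orientationSign_eq_of_eq (o : SmoothOrientation (𝓡 4) M) {x y : M} (h : o y = o x) :
    orientationSign o y = orientationSign o x := by
  classical
  simp [orientationSign, h]

/-- Points with different orientations have opposite signs (there are exactly two orientations).
[folklore] -/
theorem orientationSign_eq_neg_of_ne (o : SmoothOrientation (𝓡 4) M) {x y : M} (h : o y ≠ o x) :
    orientationSign o y = -orientationSign o x := by
  by_cases hx : o x = euclideanOrientation 4
  · rw [orientationSign_of_eq hx, orientationSign_of_ne (fun hy => h (hy.trans hx.symm))]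
  · have hx' : o x = -euclideanOrientation 4 :=
      (orientation_four_eq_or_eq_neg (o x) _).resolve_left hx
    have hy : o y = euclideanOrientation 4 := by
      rcases orientation_four_eq_or_eq_neg (o y) (euclideanOrientation 4) with hy | hy
      · exact hy
      · exact absurd (hy.trans hx'.symm) h
    rw [orientationSign_of_eq hy, orientationSign_of_ne hx, neg_neg]

/-- The opposite orientation has the opposite sign. [folklore] -/
theorem orientationSign_neg (o : SmoothOrientation (𝓡 4) M) (x : M) :
    orientationSign (-o) x = -orientationSign o x := by
  have hne : (-o) x ≠ o x := by
    rw [SmoothOrientation.neg_apply]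
    exact fun h => Module.Ray.ne_neg_self (o x) h.symm
  by_cases hx : o x = euclideanOrientation 4
  · rw [orientationSign_of_eq hx, orientationSign_of_ne (fun h => hne (h.trans hx.symm))]
  · have hx' : o x = -euclideanOrientation 4 :=
      (orientation_four_eq_or_eq_neg (o x) _).resolve_left hx
    have h2 : (-o) x = euclideanOrientation 4 := by
      rw [SmoothOrientation.neg_apply, hx']
      exact neg_neg (euclideanOrientation 4)
    rw [orientationSign_of_eq h2, orientationSign_of_ne hx, neg_neg]

/-- **The positive side `M⁺(o, ω) = {ωⁿ > 0}`** of a 2-form `s` on an oriented 4-manifold: the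
points where the Pfaffian of `s x` (on the standard basis of the preferred chart at `x`) has the
sign of the orientation `o x` ("`M⁺` where `ωⁿ > 0`": `ω ∧ ω = 2 Pf(ω) e⁰¹²³` in the
preferred chart, and `ε(o, x)` corrects for the orientation of that chart). The negative side
`M⁻ = {ωⁿ < 0}` is `posSide (-o) s`. [cite: CannasdasilvaGuilleminPires2010, §2.1] -/
def posSide (o : SmoothOrientation (𝓡 4) M) (s : MForm (𝓡 4) M ℝ 2) : Set M :=
  {x | 0 < orientationSign o x * pfaffian (s x)}

/-- Membership in the positive side `M⁺(o, ω)`. [cite: CannasdasilvaGuilleminPires2010, §2.1] -/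
theorem mem_posSide_iff (o : SmoothOrientation (𝓡 4) M) (s : MForm (𝓡 4) M ℝ 2) (x : M) :
    x ∈ posSide o s ↔ 0 < orientationSign o x * pfaffian (s x) :=
  Iff.rfl

/-- Membership in the negative side `M⁻(o, ω) = M⁺(-o, ω)`: `ε(o,x) Pf (s x) < 0`. [cite: CannasdasilvaGuilleminPires2010, §2.1] -/
theorem mem_posSide_neg_iff (o : SmoothOrientation (𝓡 4) M) (s : MForm (𝓡 4) M ℝ 2) (x : M) :
    x ∈ posSide (-o) s ↔ orientationSign o x * pfaffian (s x) < 0 := by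
  rw [mem_posSide_iff, orientationSign_neg, neg_mul, neg_pos]

/-- The two sides `M⁺`, `M⁻` are disjoint. [cite: CannasdasilvaGuilleminPires2010, §2.1] -/
theorem disjoint_posSide_posSide_neg (o : SmoothOrientation (𝓡 4) M) (s : MForm (𝓡 4) M ℝ 2) :
    Disjoint (posSide o s) (posSide (-o) s) := by
  refine Set.disjoint_left.2 fun x hx hx' => ?_
  rw [mem_posSide_iff] at hx
  rw [mem_posSide_neg_iff] at hx'
  exact lt_asymm hx hx'

/-- The two sides cover the complement of the fold: `M ∖ Z = M⁺ ⊔ M⁻` ("Away from `Z`, the form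
`ω` is nondegenerate, so `ωⁿ|_{M ∖ Z} ≠ 0`"). [cite: CannasdasilvaGuilleminPires2010, §2.1] -/
theorem posSide_union_posSide_neg (o : SmoothOrientation (𝓡 4) M) (s : MForm (𝓡 4) M ℝ 2) :
    posSide o s ∪ posSide (-o) s = (fold s)ᶜ := by
  ext x
  rw [mem_union, mem_posSide_iff, mem_posSide_neg_iff, mem_compl_iff,
    mem_fold_iff_pfaffian_eq_zero]
  constructor
  · rintro (h | h) h0 <;> simp [h0] at h
  · intro h
    have h' : orientationSign o x * pfaffian (s x) ≠ 0 :=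
      mul_ne_zero (orientationSign_ne_zero o x) h
    rcases lt_or_gt_of_ne h' with h | h
    · exact Or.inr h
    · exact Or.inl h

/-- `det A · det D = 1` for the derivative `A` of the extended chart at `x₀` and the derivative
`D` of its inverse (`dφ ∘ dφ⁻¹ = id`, Mathlib's
`mfderiv_extChartAt_comp_mfderivWithin_extChartAt_symm'`, and multiplicativity of `det`). [folklore] -/
theorem det_mfderiv_extChartAt_mul_det (x₀ : M) {y : M} (hy : y ∈ (extChartAt (𝓡 4) x₀).source) :
    LinearMap.det (M := EuclideanSpace ℝ (Fin 4))
        (mfderiv (𝓡 4) 𝓘(ℝ, EuclideanSpace ℝ (Fin 4)) (extChartAt (𝓡 4) x₀) y).toLinearMap *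
      LinearMap.det (M := EuclideanSpace ℝ (Fin 4))
        (mfderivWithin 𝓘(ℝ, EuclideanSpace ℝ (Fin 4)) (𝓡 4) (extChartAt (𝓡 4) x₀).symm
          (range (𝓡 4)) (extChartAt (𝓡 4) x₀ y)).toLinearMap = 1 := by
  have h := mfderiv_extChartAt_comp_mfderivWithin_extChartAt_symm' (I := 𝓡 4) hy
  have h' := congrArg (fun f => LinearMap.det (M := EuclideanSpace ℝ (Fin 4))
    (ContinuousLinearMap.toLinearMap f)) h
  have e1 := LinearMap.det_comp (M := EuclideanSpace ℝ (Fin 4))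
    (mfderiv (𝓡 4) 𝓘(ℝ, EuclideanSpace ℝ (Fin 4)) (extChartAt (𝓡 4) x₀) y).toLinearMap
    (mfderivWithin 𝓘(ℝ, EuclideanSpace ℝ (Fin 4)) (𝓡 4) (extChartAt (𝓡 4) x₀).symm
      (range (𝓡 4)) (extChartAt (𝓡 4) x₀ y)).toLinearMap
  exact e1.symm.trans (h'.trans LinearMap.det_id)

/-- The derivative of the extended chart at `x₀` at a point `y` of its domain is the tangent
coordinate change from the chart at `y` to the chart at `x₀` (Mathlib's
`mfderiv_chartAt_eq_tangentCoordChange`; for the boundaryless model `𝓡 4` the extended chart is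
the chart). [folklore] -/
theorem mfderiv_extChartAt_eq_tangentCoordChange' (x₀ : M) {y : M}
    (hy : y ∈ (extChartAt (𝓡 4) x₀).source) :
    mfderiv (𝓡 4) 𝓘(ℝ, EuclideanSpace ℝ (Fin 4)) (extChartAt (𝓡 4) x₀) y =
      tangentCoordChange (𝓡 4) y x₀ y := by
  rw [extChartAt_source] at hy
  rw [← mfderiv_chartAt_eq_tangentCoordChange (I := 𝓡 4) hy]
  rfl

/-- **Chart comparison of the signed Pfaffian.** Near `x₀`, the signed chart Pfaffian
`ε(o,x₀) · Pf (s.inChart x₀ (φ y))` is a POSITIVE multiple of the signed Pfaffian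
`ε(o,y) · Pf (s y)`: `Pf (s.inChart x₀ (φ y)) = det D · Pf (s y)` for the derivative `D` of
`φ⁻¹` (functoriality of the Pfaffian), `det D` has the sign of the chart-change Jacobian, and
that sign is `+` exactly when `o y = o x₀` (local constancy of a smooth orientation,
`SmoothOrientation.eventually_eq_iff`). This is the chart-independence of the sign of `ωⁿ` on an
oriented manifold. [cite: CannasdasilvaGuilleminPires2010, §2.1] -/
theorem eventually_orientationSign_mul_pfaffian_inChart (o : SmoothOrientation (𝓡 4) M)
    (s : MForm (𝓡 4) M ℝ 2) (x₀ : M) :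
    ∀ᶠ y in 𝓝 x₀, ∃ c : ℝ, 0 < c ∧
      orientationSign o x₀ * pfaffian (s.inChart x₀ (extChartAt (𝓡 4) x₀ y)) =
        c * (orientationSign o y * pfaffian (s y)) := by
  filter_upwards [o.eventually_eq_iff x₀, extChartAt_source_mem_nhds (I := 𝓡 4) x₀] with y hiff hy
  set a : ℝ := LinearMap.det ((tangentCoordChange (𝓡 4) y x₀ y :
    EuclideanSpace ℝ (Fin 4) →L[ℝ] EuclideanSpace ℝ (Fin 4)) :
    EuclideanSpace ℝ (Fin 4) →ₗ[ℝ] EuclideanSpace ℝ (Fin 4)) with ha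
  set D := mfderivWithin 𝓘(ℝ, EuclideanSpace ℝ (Fin 4)) (𝓡 4) (extChartAt (𝓡 4) x₀).symm
    (range (𝓡 4)) (extChartAt (𝓡 4) x₀ y) with hD
  set d : ℝ := LinearMap.det (M := EuclideanSpace ℝ (Fin 4)) D.toLinearMap with hd
  have had : a * d = 1 := by
    have h1 := det_mfderiv_extChartAt_mul_det x₀ hy
    rw [mfderiv_extChartAt_eq_tangentCoordChange' x₀ hy] at h1
    exact h1
  -- the chart Pfaffian is `det D · Pf (s y)` (functoriality of the Pfaffian)
  have key : ∀ {p q : M} (_ : p = q)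
      (L : EuclideanSpace ℝ (Fin 4) →L[ℝ] EuclideanSpace ℝ (Fin 4)),
      pfaffian ((s p).compContinuousLinearMap L) = pfaffian ((s q).compContinuousLinearMap L) := by
    intro p q h L
    subst h
    rfl
  have hPf : pfaffian (s.inChart x₀ (extChartAt (𝓡 4) x₀ y)) = d * pfaffian (s y) :=
    (key ((extChartAt (𝓡 4) x₀).left_inv hy) D).trans (pfaffian_compContinuousLinearMap (s y) D)
  rw [hPf]
  by_cases hpos : 0 < a
  · -- same orientation: `det D > 0`, same sign
    have hoy : o y = o x₀ := hiff.2 hpos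
    have hdpos : 0 < d := by
      by_contra hle
      push Not at hle
      have : a * d ≤ 0 := mul_nonpos_of_nonneg_of_nonpos hpos.le hle
      linarith
    refine ⟨d, hdpos, ?_⟩
    rw [orientationSign_eq_of_eq o hoy]
    ring
  · -- opposite orientation: `det D < 0`, opposite sign
    have hoy : o y ≠ o x₀ := fun h => hpos (hiff.1 h)
    have hdneg : d < 0 := by
      by_contra hle
      push Not at hle
      have ha0 : a ≤ 0 := not_lt.1 hpos
      have : a * d ≤ 0 := mul_nonpos_of_nonpos_of_nonneg ha0 hle
      linarith
    refine ⟨-d, neg_pos.2 hdneg, ?_⟩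
    rw [orientationSign_eq_neg_of_ne o hoy]
    ring

/-- **The sides are open** (§2.1: "the complement `M ∖ Z` decomposes into open subsets `M⁺`
where `ωⁿ > 0` and `M⁻` where `ωⁿ < 0`"), for a smooth form: by the chart comparison the sign
of `ε(o,y) Pf (s y)` near `x₀` is the sign of the signed chart Pfaffian, which is continuous at
the centre. [cite: CannasdasilvaGuilleminPires2010, §2.1] -/
theorem isOpen_posSide (o : SmoothOrientation (𝓡 4) M) {s : MForm (𝓡 4) M ℝ 2}
    (hs : IsSmoothForm s) : IsOpen (posSide o s) := by
  refine isOpen_iff_mem_nhds.2 fun x₀ hx₀ => ?_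
  have hev := eventually_orientationSign_mul_pfaffian_inChart o s x₀
  obtain ⟨c₀, hc₀, h₀⟩ := hev.self_of_nhds
  have hg : ContinuousAt
      (fun y => orientationSign o x₀ * pfaffian (s.inChart x₀ (extChartAt (𝓡 4) x₀ y))) x₀ :=
    continuousAt_const.mul
      ((continuousAt_pfaffian_inChart_of_isSmoothForm hs x₀).comp (continuousAt_extChartAt x₀))
  have hpos : 0 < orientationSign o x₀ * pfaffian (s.inChart x₀ (extChartAt (𝓡 4) x₀ x₀)) := by
    rw [h₀]
    exact mul_pos hc₀ hx₀
  have hnhds := hg.preimage_mem_nhds (Ioi_mem_nhds hpos)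
  filter_upwards [hnhds, hev] with y hy hyc
  obtain ⟨c, hc, hyc⟩ := hyc
  rw [mem_preimage, mem_Ioi, hyc] at hy
  exact (mul_pos_iff_of_pos_left hc).1 hy

variable {N : Type} [TopologicalSpace N] [ChartedSpace (EuclideanSpace ℝ (Fin 3)) N] {j : N → M}

/-- **Every fold point of a folded form is in the closure of both sides**: the chart Pfaffian
vanishes at the centre with non-zero derivative (`ω ∧ ω ⋔ 0`), so it takes both signs along a
line through the centre, arbitrarily close to it (and the chart comparison turns these signs into
membership in `M⁺(±o)`). [cite: CannasdasilvaGuilleminPires2010, Def. 2.1 and §2.1] -/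
theorem IsFoldedForm.mem_closure_posSide {s : MForm (𝓡 4) M ℝ 2} (h : IsFoldedForm s N j)
    (o : SmoothOrientation (𝓡 4) M) {x₀ : M} (hx₀ : x₀ ∈ fold s) :
    x₀ ∈ closure (posSide o s) := by
  rw [mem_closure_iff_nhds]
  intro U hU
  set φ := extChartAt (𝓡 4) x₀ with hφ
  set G : EuclideanSpace ℝ (Fin 4) → ℝ := fun y => pfaffian (s.inChart x₀ y) with hG
  have hG0 : G (φ x₀) = 0 := (mem_fold_iff_pfaffian_inChart_self s x₀).1 hx₀
  have hT : fderiv ℝ G (φ x₀) ≠ 0 := h.transverse x₀ hx₀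
  have hdiff : DifferentiableAt ℝ G (φ x₀) := by
    by_contra hnd
    exact hT (fderiv_zero_of_not_differentiableAt hnd)
  -- a direction of positive derivative
  obtain ⟨v, hv⟩ : ∃ v, 0 < fderiv ℝ G (φ x₀) v := by
    obtain ⟨v₀, hv₀⟩ : ∃ v₀, fderiv ℝ G (φ x₀) v₀ ≠ 0 := by
      by_contra hall
      push Not at hall
      exact hT (ContinuousLinearMap.ext hall)
    rcases lt_or_gt_of_ne hv₀ with hlt | hgt
    · exact ⟨-v₀, by rw [map_neg]; linarith⟩
    · exact ⟨v₀, hgt⟩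
  -- the line `ℓ t = φ x₀ + t • v` and `G ∘ ℓ`
  set ℓ : ℝ → EuclideanSpace ℝ (Fin 4) := fun t => φ x₀ + t • v with hℓ
  have hℓ0 : ℓ 0 = φ x₀ := by simp [hℓ]
  have hℓc : Continuous ℓ := by fun_prop
  have hderiv : HasDerivAt (G ∘ ℓ) (fderiv ℝ G (φ x₀) v) 0 := by
    have h1 : HasDerivAt ℓ v 0 := by
      have := ((hasDerivAt_id (0 : ℝ)).smul_const v).const_add (φ x₀)
      simpa [hℓ] using this
    have h2 : HasFDerivAt G (fderiv ℝ G (φ x₀)) (ℓ 0) := by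
      rw [hℓ0]
      exact hdiff.hasFDerivAt
    exact h2.comp_hasDerivAt 0 h1
  rw [hasDerivAt_iff_tendsto_slope_zero] at hderiv
  have hslope : ∀ᶠ t in 𝓝[≠] (0 : ℝ), 0 < t⁻¹ • ((G ∘ ℓ) (0 + t) - (G ∘ ℓ) 0) :=
    hderiv.eventually (Ioi_mem_nhds hv)
  -- the sign relation near `x₀` and the neighbourhood `U`, pulled back to the chart; the target
  have hW := extChartAt_preimage_mem_nhds (I := 𝓡 4)
    (Filter.inter_mem (eventually_orientationSign_mul_pfaffian_inChart o s x₀) hU)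
  have htgt : φ.target ∈ 𝓝 (φ x₀) := extChartAt_target_mem_nhds x₀
  have hline : ∀ᶠ t in 𝓝 (0 : ℝ), ℓ t ∈ φ.target ∧ ℓ t ∈ (extChartAt (𝓡 4) x₀).symm ⁻¹'
      ({y | ∃ c : ℝ, 0 < c ∧
          orientationSign o x₀ * pfaffian (s.inChart x₀ (extChartAt (𝓡 4) x₀ y)) =
            c * (orientationSign o y * pfaffian (s y))} ∩ U) := by
    have hc : ContinuousAt ℓ 0 := hℓc.continuousAt
    rw [← hℓ0] at htgt hW
    have hl1 : ∀ᶠ t in 𝓝 (0 : ℝ), ℓ t ∈ φ.target := hc.preimage_mem_nhds htgt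
    have hl2 : ∀ᶠ t in 𝓝 (0 : ℝ), ℓ t ∈ (extChartAt (𝓡 4) x₀).symm ⁻¹'
      ({y | ∃ c : ℝ, 0 < c ∧
          orientationSign o x₀ * pfaffian (s.inChart x₀ (extChartAt (𝓡 4) x₀ y)) =
            c * (orientationSign o y * pfaffian (s y))} ∩ U) := hc.preimage_mem_nhds hW
    exact hl1.and hl2
  -- value of `G` on the line: `G (ℓ t) = t * slope`
  have hval : ∀ t : ℝ, t ≠ 0 → G (ℓ t) = t * (t⁻¹ • ((G ∘ ℓ) (0 + t) - (G ∘ ℓ) 0)) := by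
    intro t ht
    simp only [comp_apply, zero_add, hℓ0, hG0, sub_zero, smul_eq_mul]
    field_simp
  -- a point on each side of the centre, inside `U`
  have hplus : ∃ t : ℝ, 0 < G (ℓ t) ∧ ℓ t ∈ φ.target ∧ (∃ c : ℝ, 0 < c ∧
      orientationSign o x₀ * pfaffian (s.inChart x₀ (φ (φ.symm (ℓ t)))) =
        c * (orientationSign o (φ.symm (ℓ t)) * pfaffian (s (φ.symm (ℓ t))))) ∧
      φ.symm (ℓ t) ∈ U := by
    have h1 : ∀ᶠ t in 𝓝[>] (0 : ℝ), 0 < t := self_mem_nhdsWithin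
    have h2 := hslope.filter_mono (nhdsWithin_mono _ fun t (ht : 0 < t) => ne_of_gt ht)
    have h3 := hline.filter_mono (nhdsWithin_le_nhds (s := Ioi (0 : ℝ)))
    obtain ⟨t, ht, hts, htl⟩ := (h1.and (h2.and h3)).exists
    refine ⟨t, ?_, htl.1, htl.2.1, htl.2.2⟩
    rw [hval t ht.ne']
    exact mul_pos ht hts
  have hminus : ∃ t : ℝ, G (ℓ t) < 0 ∧ ℓ t ∈ φ.target ∧ (∃ c : ℝ, 0 < c ∧
      orientationSign o x₀ * pfaffian (s.inChart x₀ (φ (φ.symm (ℓ t)))) =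
        c * (orientationSign o (φ.symm (ℓ t)) * pfaffian (s (φ.symm (ℓ t))))) ∧
      φ.symm (ℓ t) ∈ U := by
    have h1 : ∀ᶠ t in 𝓝[<] (0 : ℝ), t < 0 := self_mem_nhdsWithin
    have h2 := hslope.filter_mono (nhdsWithin_mono _ fun t (ht : t < 0) => ne_of_lt ht)
    have h3 := hline.filter_mono (nhdsWithin_le_nhds (s := Iio (0 : ℝ)))
    obtain ⟨t, ht, hts, htl⟩ := (h1.and (h2.and h3)).exists
    refine ⟨t, ?_, htl.1, htl.2.1, htl.2.2⟩
    rw [hval t ht.ne]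
    exact mul_neg_of_neg_of_pos ht hts
  rcases orientationSign_eq_one_or o x₀ with h1 | h1
  · obtain ⟨t, hGt, htgt', ⟨c, hc, hrel⟩, hU'⟩ := hplus
    refine ⟨φ.symm (ℓ t), hU', ?_⟩
    rw [mem_posSide_iff]
    rw [φ.right_inv htgt', h1, one_mul] at hrel
    have : 0 < c * (orientationSign o (φ.symm (ℓ t)) * pfaffian (s (φ.symm (ℓ t)))) := by
      rw [← hrel]; exact hGt
    exact (mul_pos_iff_of_pos_left hc).1 this
  · obtain ⟨t, hGt, htgt', ⟨c, hc, hrel⟩, hU'⟩ := hminus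
    refine ⟨φ.symm (ℓ t), hU', ?_⟩
    rw [mem_posSide_iff]
    rw [φ.right_inv htgt', h1, neg_one_mul] at hrel
    have : 0 < c * (orientationSign o (φ.symm (ℓ t)) * pfaffian (s (φ.symm (ℓ t)))) := by
      rw [← hrel]; linarith
    exact (mul_pos_iff_of_pos_left hc).1 this

/-- **Both sides are non-empty** as soon as the fold of a folded form is: `M⁺` and `M⁻` meet
every neighbourhood of the fold. [cite: CannasdasilvaGuilleminPires2010, Def. 2.1 and §2.1] -/
theorem IsFoldedForm.posSide_nonempty {s : MForm (𝓡 4) M ℝ 2} (h : IsFoldedForm s N j)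
    (o : SmoothOrientation (𝓡 4) M) {x₀ : M} (hx₀ : x₀ ∈ fold s) : (posSide o s).Nonempty := by
  by_contra hne
  have he : posSide o s = ∅ := not_nonempty_iff_eq_empty.1 hne
  have := h.mem_closure_posSide o hx₀
  rw [he, closure_empty] at this
  exact this

/-- The fold does not meet the sides. [cite: CannasdasilvaGuilleminPires2010, §2.1] -/
theorem fold_inter_posSide (o : SmoothOrientation (𝓡 4) M) (s : MForm (𝓡 4) M ℝ 2) :
    fold s ∩ posSide o s = ∅ := by
  refine Set.eq_empty_iff_forall_notMem.2 fun x hx => ?_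
  have h1 : pfaffian (s x) = 0 := (mem_fold_iff_pfaffian_eq_zero s x).1 hx.1
  have h2 := hx.2
  rw [mem_posSide_iff, h1, mul_zero] at h2
  exact lt_irrefl 0 h2

/-- The complement of the negative side is `M⁺ ∪ Z`. [cite: CannasdasilvaGuilleminPires2010, §2.1] -/
theorem compl_posSide_neg (o : SmoothOrientation (𝓡 4) M) (s : MForm (𝓡 4) M ℝ 2) :
    (posSide (-o) s)ᶜ = posSide o s ∪ fold s := by
  ext x
  have hu := Set.ext_iff.1 (posSide_union_posSide_neg o s) x
  have hd : x ∈ posSide o s → x ∉ posSide (-o) s :=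
    fun hx => Set.disjoint_left.1 (disjoint_posSide_posSide_neg o s) hx
  simp only [mem_union, mem_compl_iff] at hu hd ⊢
  tauto

/-- **`closure M⁺ = M⁺ ∪ Z`** for a folded form: `M⁺ ∪ Z` is closed (complement of the open
`M⁻`) and `Z ⊆ closure M⁺`. [cite: CannasdasilvaGuilleminPires2010, §2.1] -/
theorem IsFoldedForm.closure_posSide {s : MForm (𝓡 4) M ℝ 2} (h : IsFoldedForm s N j)
    (o : SmoothOrientation (𝓡 4) M) : closure (posSide o s) = posSide o s ∪ fold s := by
  apply Subset.antisymm
  · rw [← compl_posSide_neg]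
    refine closure_minimal ?_ (isOpen_posSide (-o) h.smooth).isClosed_compl
    exact Set.disjoint_left.1 (disjoint_posSide_posSide_neg o s)
  · exact union_subset subset_closure fun x hx => h.mem_closure_posSide o hx

/-- **`∂M⁺ = Z`**: the fold is the common frontier of the two sides of a folded form.
[cite: CannasdasilvaGuilleminPires2010, §2.1] -/
theorem IsFoldedForm.frontier_posSide {s : MForm (𝓡 4) M ℝ 2} (h : IsFoldedForm s N j)
    (o : SmoothOrientation (𝓡 4) M) : frontier (posSide o s) = fold s := by
  rw [frontier, h.closure_posSide o, (isOpen_posSide o h.smooth).interior_eq]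
  ext x
  have hd := Set.eq_empty_iff_forall_notMem.1 (fold_inter_posSide o s) x
  simp only [Set.mem_sdiff, mem_union, mem_inter_iff] at hd ⊢
  tauto

/-- **Step (S0) of the unfolding, point-set form.** On an oriented 4-manifold carrying an
origami form with non-empty fold, the complement of the fold is the disjoint union of the two
non-empty open sides `M⁺ = {ω² > 0}` and `M⁻ = {ω² < 0}` — the first conjunct of
`exists_symplecticCutPieces_of_isOrigamiForm` (Cannas da Silva–Guillemin–Pires 2010, §2.1 and
Prop. 2.8: the pieces `M⁺`, `M⁻` that are completed to the cut pieces `M₀^±`).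
[cite: CannasdasilvaGuilleminPires2010, §2.1, Prop. 2.8] -/
theorem IsOrigamiForm.exists_sides {s : MForm (𝓡 4) M ℝ 2} (hs : IsOrigamiForm s)
    (hM : IsOrientable (𝓡 4) M) (hZ : (fold s).Nonempty) :
    ∃ V : Fin 2 → TopologicalSpace.Opens M,
      Disjoint (V 0) (V 1) ∧ (∀ i, (V i : Set M).Nonempty) ∧
        ((V 0 : Set M) ∪ (V 1 : Set M))ᶜ = fold s := by
  obtain ⟨o⟩ := hM
  obtain ⟨N, _, _, _, _, j, hf⟩ := hs.exists_isFoldedForm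
  obtain ⟨x₀, hx₀⟩ := hZ
  refine ⟨![⟨posSide o s, isOpen_posSide o hf.smooth⟩, ⟨posSide (-o) s, isOpen_posSide (-o) hf.smooth⟩],
    ?_, ?_, ?_⟩
  · rw [← TopologicalSpace.Opens.coe_disjoint]
    exact disjoint_posSide_posSide_neg o s
  · intro i
    fin_cases i
    · exact hf.posSide_nonempty o hx₀
    · exact hf.posSide_nonempty (-o) hx₀
  · change (posSide o s ∪ posSide (-o) s)ᶜ = fold s
    rw [posSide_union_posSide_neg, compl_compl]

end Sides

end Literature.Geometry.Symplectic

end
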